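import Summits.NavierStokesRegularity.NavierStokesRegularity.Theorems.UnthreadedDoorNetFluxDefs
import Summits.NavierStokesRegularity.NavierStokesRegularity.Theorems.UnthreadedDoorNetFluxTypeIVorticityBound
import Literature.Analysis.FluidPDE.HalfLineOUComparison
import HarnessLib

/-!
# The netflux line's stratum target reduces to S⁺ (crux `PoloidalLiouville`, stmt-NavierStokesRegularity-1222, W1)

Support file for crux `PoloidalLiouville` (line «netflux-typei-gap» of planner ns-idea-14; objects and statements in
`…Theorems.PoloidalLiouville.NetFlux`, file `UnthreadedDoorNetFluxDefs.lean`).  Experiment cell ARM A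
`pub/ns-exp-scalarLiouville` (D-0160), generation g3.  Theorems only; nothing here proves `PoloidalLiouville`,
`stub_scalarLiouville` or Navier–Stokes regularity; the line's analytic content (NF-1 and the composition to S⁺) is OPEN.

* `NetFlux.typeIVorticityBound_holds : TypeIVorticityBound` (NF-2, by name; p660105) and
  `NetFlux.halfLineOUDecay_holds : HalfLineOUDecay` (NF-3, by name; `HalfLineOU.halfLineOU_decay`, p658091).
* `NetFlux.unimodalScalarLiouvilleTypeI_of_netFluxWindowDecay : NetFluxWindowDecay → UnimodalScalarLiouvilleTypeI` —
  **the stratum theorem candidate of the line follows from the window statement S⁺ alone** (the second conjunct of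
  `LineComposition`, with NF-2 now a theorem): for ancient data the window bound
  `∫₀^R r·osc_{S_r}T(t) dr ≤ A·C₁·(1 + R/√(−t))³·(t/t₁)^λ` is available for every `t₁ ≤ t`, and `t₁ → −∞` kills it;
  `r ↦ r·osc_{S_r}T(t)` is continuous and nonnegative on `(0,∞)` (`continuousOn_sphSup`, compactness of the sphere), so it
  vanishes; a function constant on every sphere about `x₀` and differentiable off `x₀` has radial gradient
  (`cross_gradient_eq_zero_of_sphere_const`), i.e. `∇T × (x − x₀) = 0`.
* `NetFlux.lineComposition_right : NetFluxWindowDecay → TypeIVorticityBound → UnimodalScalarLiouvilleTypeI`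
  (the literal second conjunct of `LineComposition`).

## References
* planner ns-idea-14, `Cruxes/PoloidalLiouville/Ideas/netflux-typei-gap.md`, `…/NetFluxTransportSketch.lean` (5fd3888d1cdd).
* G. Koch, N. Nadirashvili, G. Seregin, V. Šverák, Acta Math. 203 (2009) = arXiv:0709.3599, (1.4), §4, Thm 5.2.
  [KochNadirashviliSereginSverak2009]
-/

-- the summit and its single problem share the name (D-0017 nested layout)
set_option linter.dupNamespace false

noncomputable section

namespace Summit.NavierStokesRegularity.NavierStokesRegularity.Theorems.PoloidalLiouville.NetFlux

open MeasureTheory Filter Set Function Metric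
open scoped Topology RealInnerProductSpace InnerProductSpace
open Literature.Analysis Literature.Analysis.FluidPDE

/-! ### NF-2 and NF-3 by name -/

/-- **NF-2 by name**: `TypeIVorticityBound` holds (`PoloidalLiouville.NetFlux.typeIVorticityBound`, p660105). -/
theorem typeIVorticityBound_holds : TypeIVorticityBound := NetFlux.typeIVorticityBound

/-- **NF-3 by name**: `HalfLineOUDecay` holds (`Literature.Analysis.FluidPDE.HalfLineOU.halfLineOU_decay`, p658091). -/
theorem halfLineOUDecay_holds : HalfLineOUDecay := HalfLineOU.halfLineOU_decay

/-! ### Spherical sup / inf: order facts -/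

/-- For `0 ≤ r` the sphere `S_r(x₀) ⊂ ℝ³` is nonempty. -/
theorem sphere_nonempty (x₀ : E3) {r : ℝ} (hr : 0 ≤ r) : (Metric.sphere x₀ r).Nonempty :=
  (NormedSpace.sphere_nonempty).2 hr

/-- `sphInf f x₀ r ≤ f y ≤ sphSup f x₀ r` for `y ∈ S_r(x₀)` when `|f| ≤ M`. -/
theorem sphInf_le_le_sphSup {f : E3 → ℝ} {M : ℝ} (hM : ∀ x, |f x| ≤ M) (x₀ : E3) {r : ℝ} {y : E3}
    (hy : y ∈ Metric.sphere x₀ r) : sphInf f x₀ r ≤ f y ∧ f y ≤ sphSup f x₀ r := by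
  have hab : BddAbove (f '' Metric.sphere x₀ r) := ⟨M, by
    rintro _ ⟨z, -, rfl⟩; exact le_of_abs_le (hM z)⟩
  have hbe : BddBelow (f '' Metric.sphere x₀ r) := ⟨-M, by
    rintro _ ⟨z, -, rfl⟩; exact neg_le_of_abs_le (hM z)⟩
  exact ⟨csInf_le hbe (mem_image_of_mem f hy), le_csSup hab (mem_image_of_mem f hy)⟩

/-- `0 ≤ sphOsc f x₀ r` for `0 ≤ r` and bounded `f`. -/
theorem sphOsc_nonneg {f : E3 → ℝ} {M : ℝ} (hM : ∀ x, |f x| ≤ M) (x₀ : E3) {r : ℝ} (hr : 0 ≤ r) :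
    0 ≤ sphOsc f x₀ r := by
  obtain ⟨y, hy⟩ := sphere_nonempty x₀ hr
  have h := sphInf_le_le_sphSup hM x₀ hy
  unfold sphOsc
  linarith [h.1, h.2]

/-- If `sphOsc f x₀ r = 0` (bounded `f`) then `f` is constant on `S_r(x₀)`. -/
theorem sphere_const_of_sphOsc_eq_zero {f : E3 → ℝ} {M : ℝ} (hM : ∀ x, |f x| ≤ M) (x₀ : E3) {r : ℝ}
    (h0 : sphOsc f x₀ r = 0) {y z : E3} (hy : y ∈ Metric.sphere x₀ r) (hz : z ∈ Metric.sphere x₀ r) :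
    f y = f z := by
  have h1 := sphInf_le_le_sphSup hM x₀ hy
  have h2 := sphInf_le_le_sphSup hM x₀ hz
  unfold sphOsc at h0
  linarith [h1.1, h1.2, h2.1, h2.2]

/-! ### Spherical sup / inf: continuity in the radius -/

/-- The sphere `S_ρ(x₀)`, `ρ > 0`, is the image of the unit sphere under `y ↦ x₀ + ρ y`. -/
theorem image_unitSphere_eq (f : E3 → ℝ) (x₀ : E3) {ρ : ℝ} (hρ : 0 < ρ) :
    (fun y : Metric.sphere (0 : E3) 1 => f (x₀ + ρ • (y : E3))) '' univ = f '' Metric.sphere x₀ ρ := by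
  ext c
  constructor
  · rintro ⟨y, -, rfl⟩
    refine ⟨x₀ + ρ • (y : E3), ?_, rfl⟩
    have hy : ‖(y : E3)‖ = 1 := mem_sphere_zero_iff_norm.1 y.2
    rw [mem_sphere_iff_norm, add_sub_cancel_left, norm_smul, Real.norm_of_nonneg hρ.le, hy, mul_one]
  · rintro ⟨x, hx, rfl⟩
    rw [mem_sphere_iff_norm] at hx
    have hy : ρ⁻¹ • (x - x₀) ∈ Metric.sphere (0 : E3) 1 := by
      rw [mem_sphere_iff_norm, sub_zero, norm_smul, norm_inv, Real.norm_of_nonneg hρ.le, hx,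
        inv_mul_cancel₀ hρ.ne']
    refine ⟨⟨ρ⁻¹ • (x - x₀), hy⟩, mem_univ _, ?_⟩
    show f (x₀ + ρ • (ρ⁻¹ • (x - x₀))) = f x
    rw [smul_smul, mul_inv_cancel₀ hρ.ne', one_smul, add_sub_cancel]

/-- The scaled parametrisation `(ρ, y) ↦ f (x₀ + max ρ ρ₁ • y)` of the spheres by the unit sphere is jointly continuous
when `f` is continuous off `x₀` and `ρ₁ > 0`. -/
theorem continuous_param {f : E3 → ℝ} {x₀ : E3} (hf : ContinuousOn f {x₀}ᶜ) {ρ₁ : ℝ} (hρ₁ : 0 < ρ₁) :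
    Continuous ↿(fun (ρ : ℝ) (y : Metric.sphere (0 : E3) 1) => f (x₀ + max ρ ρ₁ • (y : E3))) := by
  have hmap : Continuous fun p : ℝ × Metric.sphere (0 : E3) 1 => x₀ + max p.1 ρ₁ • (p.2 : E3) :=
    continuous_const.add ((continuous_fst.max continuous_const).smul
      (continuous_subtype_val.comp continuous_snd))
  refine hf.comp_continuous hmap fun p => ?_
  have hy : ‖(p.2 : E3)‖ = 1 := mem_sphere_zero_iff_norm.1 p.2.2
  have hpos : 0 < max p.1 ρ₁ := lt_max_of_lt_right hρ₁
  rw [mem_compl_singleton_iff, ne_eq, add_eq_left, smul_eq_zero, not_or]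
  exact ⟨hpos.ne', fun h => by simp [h] at hy⟩

/-- **`r ↦ max_{S_r(x₀)} f` is continuous on `(0,∞)`** for `f` continuous off `x₀` (compactness of the sphere,
`IsCompact.continuous_sSup`). -/
theorem continuousOn_sphSup {f : E3 → ℝ} {x₀ : E3} (hf : ContinuousOn f {x₀}ᶜ) :
    ContinuousOn (fun r => sphSup f x₀ r) (Ioi 0) := by
  intro r₀ hr₀
  have hr₀' : (0 : ℝ) < r₀ := hr₀
  have hρ₁ : 0 < r₀ / 2 := by linarith
  have hK : IsCompact (univ : Set (Metric.sphere (0 : E3) 1)) := isCompact_univ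
  have hc := hK.continuous_sSup (continuous_param hf hρ₁)
  have hev : (fun r => sSup ((fun y : Metric.sphere (0 : E3) 1 => f (x₀ + max r (r₀ / 2) • (y : E3))) '' univ))
      =ᶠ[𝓝 r₀] fun r => sphSup f x₀ r := by
    filter_upwards [Ioi_mem_nhds (show r₀ / 2 < r₀ by linarith)] with r hr
    have hr' : max r (r₀ / 2) = r := max_eq_left (le_of_lt hr)
    simp only [hr']
    rw [image_unitSphere_eq f x₀ (hρ₁.trans hr)]
    rfl
  exact (hc.continuousAt.congr hev).continuousWithinAt

/-- **`r ↦ min_{S_r(x₀)} f` is continuous on `(0,∞)`** for `f` continuous off `x₀`. -/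
theorem continuousOn_sphInf {f : E3 → ℝ} {x₀ : E3} (hf : ContinuousOn f {x₀}ᶜ) :
    ContinuousOn (fun r => sphInf f x₀ r) (Ioi 0) := by
  intro r₀ hr₀
  have hr₀' : (0 : ℝ) < r₀ := hr₀
  have hρ₁ : 0 < r₀ / 2 := by linarith
  have hK : IsCompact (univ : Set (Metric.sphere (0 : E3) 1)) := isCompact_univ
  have hc := hK.continuous_sInf (continuous_param hf hρ₁)
  have hev : (fun r => sInf ((fun y : Metric.sphere (0 : E3) 1 => f (x₀ + max r (r₀ / 2) • (y : E3))) '' univ))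
      =ᶠ[𝓝 r₀] fun r => sphInf f x₀ r := by
    filter_upwards [Ioi_mem_nhds (show r₀ / 2 < r₀ by linarith)] with r hr
    have hr' : max r (r₀ / 2) = r := max_eq_left (le_of_lt hr)
    simp only [hr']
    rw [image_unitSphere_eq f x₀ (hρ₁.trans hr)]
    rfl
  exact (hc.continuousAt.congr hev).continuousWithinAt

/-- `r ↦ r·osc_{S_r(x₀)} f` is continuous on `(0,∞)` for `f` continuous off `x₀`. -/
theorem continuousOn_netFlux {f : E3 → ℝ} {x₀ : E3} (hf : ContinuousOn f {x₀}ᶜ) :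
    ContinuousOn (fun r => netFlux f x₀ r) (Ioi 0) := by
  unfold netFlux sphOsc
  exact continuousOn_id.mul ((continuousOn_sphSup hf).sub (continuousOn_sphInf hf))

/-! ### A nonnegative continuous density with nonpositive integrals vanishes -/

/-- If `g ≥ 0` is continuous on `(0,∞)`, bounded on each `(0,R)`, and `∫_{(0,R)} g ≤ 0` for every `R > 0`, then `g = 0`
on `(0,∞)`. -/
theorem eq_zero_of_setIntegral_nonpos {g : ℝ → ℝ} (hg0 : ∀ r, 0 < r → 0 ≤ g r) (hgc : ContinuousOn g (Ioi 0))
    (hgb : ∀ R, 0 < R → ∃ M, ∀ r ∈ Ioo 0 R, |g r| ≤ M)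
    (hint : ∀ R, 0 < R → ∫ r in Ioo 0 R, g r ≤ 0) : ∀ r, 0 < r → g r = 0 := by
  intro r₀ hr₀
  by_contra hne
  have hpos : 0 < g r₀ := lt_of_le_of_ne (hg0 r₀ hr₀) (Ne.symm hne)
  -- continuity at `r₀` within `(0,∞)`
  have hcw := hgc r₀ hr₀
  rw [Metric.continuousWithinAt_iff] at hcw
  obtain ⟨δ, hδ, hδ'⟩ := hcw (g r₀ / 2) (by linarith)
  set δ' : ℝ := min δ r₀ with hδ'def
  have hδ'0 : 0 < δ' := lt_min hδ hr₀
  have hδ'δ : δ' ≤ δ := min_le_left _ _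
  have hδ'r : δ' ≤ r₀ := min_le_right _ _
  set a : ℝ := r₀ - δ' / 2 with ha
  set b : ℝ := r₀ + δ' / 2 with hb
  have ha0 : 0 < a := by rw [ha]; linarith
  have hab : a < b := by rw [ha, hb]; linarith
  -- on `(a,b)`: `g > g r₀ / 2`
  have hlow : ∀ r ∈ Ioo a b, g r₀ / 2 ≤ g r := by
    intro r hr
    have hr0 : 0 < r := ha0.trans hr.1
    have hdist : dist r r₀ < δ := by
      rw [Real.dist_eq, abs_lt]
      rw [ha] at hr; rw [hb] at hr
      constructor <;> linarith [hr.1, hr.2]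
    have h := hδ' hr0 hdist
    rw [Real.dist_eq, abs_lt] at h
    linarith [h.1]
  -- integrability on `(0,b)`
  obtain ⟨M, hM⟩ := hgb b (ha0.trans hab)
  have hmeas : AEStronglyMeasurable g (volume.restrict (Ioo 0 b)) :=
    (hgc.mono Ioo_subset_Ioi_self).aestronglyMeasurable measurableSet_Ioo
  have hbdd : ∀ᵐ r ∂(volume.restrict (Ioo 0 b)), ‖g r‖ ≤ (fun _ : ℝ => M) r :=
    (ae_restrict_iff' measurableSet_Ioo).2 (ae_of_all _ fun r hr => by
      rw [Real.norm_eq_abs]; exact hM r hr)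
  have hInt : IntegrableOn g (Ioo 0 b) volume :=
    Integrable.mono' (integrableOn_const measure_Ioo_lt_top.ne) hmeas hbdd
  have hIntab : IntegrableOn g (Ioo a b) volume := hInt.mono_set (Ioo_subset_Ioo_left ha0.le)
  -- `∫_{(a,b)} g ≥ (b - a) g(r₀)/2 > 0`
  have h1 : (g r₀ / 2) * (b - a) ≤ ∫ r in Ioo a b, g r := by
    have hc : ∫ _ in Ioo a b, g r₀ / 2 = (g r₀ / 2) * (b - a) := by
      rw [setIntegral_const, Real.volume_real_Ioo_of_le hab.le, smul_eq_mul, mul_comm]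
    rw [← hc]
    exact setIntegral_mono_on (integrableOn_const measure_Ioo_lt_top.ne) hIntab measurableSet_Ioo hlow
  have h2 : ∫ r in Ioo a b, g r ≤ ∫ r in Ioo 0 b, g r :=
    setIntegral_mono_set hInt ((ae_restrict_iff' measurableSet_Ioo).2
      (ae_of_all _ fun r hr => hg0 r hr.1)) (Ioo_subset_Ioo_left ha0.le).eventuallyLE
  have h3 := hint b (ha0.trans hab)
  have h4 : 0 < (g r₀ / 2) * (b - a) := mul_pos (by linarith) (by linarith)
  linarith

/-! ### Radial functions have radial gradient -/

/-- `a × 0 = 0` for the tree's cross product on `ℝ³`. -/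
theorem cross_zero_right (a : E3) : cross a 0 = 0 := by
  simp [cross]

/-- `(c • u) × u = 0`. -/
theorem cross_smul_self (c : ℝ) (u : E3) : cross (c • u) u = 0 := by
  simp [cross, cross_self]

/-- **A function constant on every sphere about `x₀` and differentiable off `x₀` has radial gradient**:
`∇f(x) × (x − x₀) = 0` for all `x` (at `x = x₀` trivially).  Indeed `f(y) = ψ(‖y − x₀‖²)` with
`ψ(q) = f(x₀ + (√q/‖u‖) u)`, `u = x − x₀ ≠ 0`, `ψ` differentiable at `‖u‖²`, so `∇f(x) = 2ψ'(‖u‖²) u`. -/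
theorem cross_gradient_eq_zero_of_sphere_const {f : E3 → ℝ} {x₀ : E3} (hf : DifferentiableOn ℝ f {x₀}ᶜ)
    (hrad : ∀ y z : E3, ‖y - x₀‖ = ‖z - x₀‖ → f y = f z) (x : E3) :
    cross (gradient f x) (x - x₀) = 0 := by
  by_cases hx : x = x₀
  · rw [hx, sub_self, cross_zero_right]
  set u : E3 := x - x₀ with hu
  have hu0 : u ≠ 0 := sub_ne_zero.2 hx
  have hun : 0 < ‖u‖ := norm_pos_iff.2 hu0
  -- the radial profile through the direction of `u`
  set ψ : ℝ → ℝ := fun q => f (x₀ + (Real.sqrt q / ‖u‖) • u) with hψ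
  have hfeq : f = fun y => ψ (‖y - x₀‖ ^ 2) := by
    funext y
    apply hrad
    rw [Real.sqrt_sq (norm_nonneg _), add_sub_cancel_left, norm_smul, norm_div, Real.norm_of_nonneg (norm_nonneg _),
      Real.norm_of_nonneg hun.le, div_mul_cancel₀ _ hun.ne']
  -- `ψ` is differentiable at `q₀ = ‖u‖²`
  set q₀ : ℝ := ‖u‖ ^ 2 with hq₀
  have hq₀0 : 0 < q₀ := by positivity
  have hℓ : DifferentiableAt ℝ (fun q : ℝ => x₀ + (Real.sqrt q / ‖u‖) • u) q₀ :=
    ((((Real.hasDerivAt_sqrt hq₀0.ne').differentiableAt).div_const _).smul_const u).const_add x₀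
  have hℓq : x₀ + (Real.sqrt q₀ / ‖u‖) • u = x := by
    rw [hq₀, Real.sqrt_sq hun.le, div_self hun.ne', one_smul, hu, add_sub_cancel]
  have hfx : DifferentiableAt ℝ f x := hf.differentiableAt (isOpen_compl_singleton.mem_nhds hx)
  have hψd : DifferentiableAt ℝ ψ q₀ := by
    have hfx' : DifferentiableAt ℝ f (x₀ + (Real.sqrt q₀ / ‖u‖) • u) := by rw [hℓq]; exact hfx
    exact hfx'.comp q₀ hℓ
  -- the gradient of `y ↦ ψ(‖y − x₀‖²)` at `x` is `(2 ψ'(q₀)) • u`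
  have hN : HasFDerivAt (fun y : E3 => ‖y - x₀‖ ^ 2) (2 • (innerSL ℝ (x - x₀)).comp (ContinuousLinearMap.id ℝ E3)) x :=
    ((hasFDerivAt_id x).sub_const x₀).norm_sq
  have hcomp : HasFDerivAt (fun y : E3 => ψ (‖y - x₀‖ ^ 2))
      (deriv ψ q₀ • (2 • (innerSL ℝ (x - x₀)).comp (ContinuousLinearMap.id ℝ E3))) x := by
    have hψ' : HasDerivAt ψ (deriv ψ q₀) (‖x - x₀‖ ^ 2) := by rw [← hu]; exact hψd.hasDerivAt
    exact hψ'.comp_hasFDerivAt x hN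
  have hL : (InnerProductSpace.toDual ℝ E3) ((2 * deriv ψ q₀) • u)
      = deriv ψ q₀ • (2 • (innerSL ℝ (x - x₀)).comp (ContinuousLinearMap.id ℝ E3)) := by
    refine ContinuousLinearMap.ext fun w => ?_
    rw [InnerProductSpace.toDual_apply_apply]
    simp only [FunLike.coe_smul, Pi.smul_apply, ContinuousLinearMap.comp_apply,
      ContinuousLinearMap.id_apply, innerSL_apply_apply, real_inner_smul_left, smul_eq_mul, hu]
    ring
  have hgrad : HasGradientAt f ((2 * deriv ψ q₀) • u) x := by
    rw [hasGradientAt_iff_hasFDerivAt, hfeq, hL]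
    exact hcomp
  rw [hgrad.gradient]
  exact cross_smul_self _ _

/-! ### The reduction: S⁺ ⇒ the stratum target -/

/-- **The stratum theorem candidate of the netflux line follows from S⁺.**  `NetFluxWindowDecay` (window decay of the
cumulative net toroidal flux in the Type-I class, for every backward window) implies `UnimodalScalarLiouvilleTypeI`:
for an ancient datum the window bound holds for every `t₁ ≤ t` with the SAME `λ, A` and with `C₁` from
`typeIVorticityBound` (NF-2); letting `t₁ → −∞` gives `∫₀^R r·osc_{S_r}T(t) dr ≤ 0`, the integrand is continuous and
nonnegative on `(0,∞)`, hence zero, so `T(t)` is constant on every sphere about `x₀`, and its gradient is radial. -/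
theorem unimodalScalarLiouvilleTypeI_of_netFluxWindowDecay (hS : NetFluxWindowDecay) :
    UnimodalScalarLiouvilleTypeI := by
  intro v x₀ T hC hB _hmeas hsv hsT hTb hrep hE huni t ht x
  obtain ⟨C, hCv⟩ := hC
  obtain ⟨CT, hCT⟩ := hTb
  -- `0 ≤ C`
  have hC0 : 0 ≤ C := by
    have h := hCv (-1) (by norm_num) 0
    rw [neg_neg, Real.sqrt_one, div_one] at h
    exact (norm_nonneg _).trans h
  obtain ⟨lam, hlam, A, hA⟩ := hS C hC0
  obtain ⟨C₁, hC₁⟩ := NetFlux.typeIVorticityBound v C hB hCv hsv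
  -- ### the window bound at time `t`, for every `t₁ ≤ t` and `R > 0`
  have hwin : ∀ t₁ : ℝ, t₁ ≤ t → ∀ R : ℝ, 0 < R →
      ∫ r in Ioo 0 R, netFlux (T t) x₀ r ≤ A * C₁ * (1 + R / Real.sqrt (-t)) ^ 3 * (t / t₁) ^ lam := by
    intro t₁ ht₁ R hR
    have ht₀ : t₁ - 1 < 0 := by linarith
    have hsub : Ioo (t₁ - 1) 0 ⊆ Iio (0 : ℝ) := Ioo_subset_Iio_self
    exact hA v x₀ T C₁ (t₁ - 1) ht₀ (hsv.mono (prod_mono hsub le_rfl)) (hsT.mono (prod_mono hsub le_rfl))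
      (fun s hs => hCv s hs.2) (fun s hs => hC₁ s hs.2) (fun s hs => hrep s hs.2) (fun s hs => hE s (hsub hs))
      (fun s hs => huni s hs.2) t₁ t R (by linarith) ht₁ ht hR
  -- ### letting `t₁ → −∞`: the integrals are `≤ 0`
  have hint : ∀ R : ℝ, 0 < R → ∫ r in Ioo 0 R, netFlux (T t) x₀ r ≤ 0 := by
    intro R hR
    set D : ℝ := A * C₁ * (1 + R / Real.sqrt (-t)) ^ 3 with hD
    refine le_of_forall_pos_le_add fun δ hδ => ?_
    rw [zero_add]
    -- choose `t₁ ≤ t` with `|D| (t/t₁)^λ ≤ δ`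
    set m : ℝ := min ((δ / (|D| + 1)) ^ (1 / lam)) 1 with hm
    have hq0 : 0 < δ / (|D| + 1) := div_pos hδ (by positivity)
    have hm0 : 0 < m := lt_min (Real.rpow_pos_of_pos hq0 _) one_pos
    have hm1 : m ≤ 1 := min_le_right _ _
    set t₁ : ℝ := t / m with ht₁
    have ht₁t : t₁ ≤ t := by
      rw [ht₁, div_le_iff₀ hm0]; nlinarith
    have hquot : t / t₁ = m := by
      rw [ht₁, div_div_eq_mul_div, mul_comm, mul_div_assoc, div_self ht.ne, mul_one]
    have h := hwin t₁ ht₁t R hR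
    rw [hquot, ← hD] at h
    have hmpow : m ^ lam ≤ δ / (|D| + 1) := by
      have h1 : m ^ lam ≤ ((δ / (|D| + 1)) ^ (1 / lam)) ^ lam :=
        Real.rpow_le_rpow hm0.le (min_le_left _ _) hlam.le
      rw [← Real.rpow_mul hq0.le, one_div_mul_cancel hlam.ne', Real.rpow_one] at h1
      exact h1
    have hmpow0 : 0 ≤ m ^ lam := Real.rpow_nonneg hm0.le _
    calc ∫ r in Ioo 0 R, netFlux (T t) x₀ r ≤ D * m ^ lam := h
      _ ≤ |D| * m ^ lam := by gcongr; exact le_abs_self D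
      _ ≤ |D| * (δ / (|D| + 1)) := by gcongr
      _ ≤ δ := by
          rw [mul_div_assoc']
          rw [div_le_iff₀ (by positivity)]
          nlinarith [abs_nonneg D]
  -- ### the density `r ↦ r·osc` is continuous, nonnegative and bounded on `(0,R)`: it vanishes
  have hTc : ContinuousOn (T t) {x₀}ᶜ :=
    (hsT.continuousOn.comp (continuous_const.prodMk continuous_id).continuousOn fun y hy =>
      mk_mem_prod (mem_Iio.2 ht) hy)
  have hTb' : ∀ y, |T t y| ≤ CT := fun y => hCT t ht y
  have hg0 : ∀ r, 0 < r → 0 ≤ netFlux (T t) x₀ r := fun r hr =>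
    mul_nonneg hr.le (sphOsc_nonneg hTb' x₀ hr.le)
  have hgb : ∀ R, 0 < R → ∃ M, ∀ r ∈ Ioo 0 R, |netFlux (T t) x₀ r| ≤ M := by
    intro R hR
    refine ⟨R * (2 * CT), fun r hr => ?_⟩
    rw [abs_of_nonneg (hg0 r hr.1)]
    unfold netFlux
    have hosc : sphOsc (T t) x₀ r ≤ 2 * CT := by
      obtain ⟨y, hy⟩ := sphere_nonempty x₀ hr.1.le
      have h := sphInf_le_le_sphSup hTb' x₀ hy
      -- `sSup ≤ CT`, `−CT ≤ sInf`
      have hab : BddAbove (T t '' Metric.sphere x₀ r) := ⟨CT, by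
        rintro _ ⟨z, -, rfl⟩; exact le_of_abs_le (hTb' z)⟩
      have hbe : BddBelow (T t '' Metric.sphere x₀ r) := ⟨-CT, by
        rintro _ ⟨z, -, rfl⟩; exact neg_le_of_abs_le (hTb' z)⟩
      have hne : (T t '' Metric.sphere x₀ r).Nonempty := ⟨_, mem_image_of_mem _ hy⟩
      have hsup : sphSup (T t) x₀ r ≤ CT := csSup_le hne (by rintro _ ⟨z, -, rfl⟩; exact le_of_abs_le (hTb' z))
      have hinf : -CT ≤ sphInf (T t) x₀ r := le_csInf hne (by rintro _ ⟨z, -, rfl⟩; exact neg_le_of_abs_le (hTb' z))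
      unfold sphOsc; linarith
    exact mul_le_mul hr.2.le hosc (sphOsc_nonneg hTb' x₀ hr.1.le) hR.le
  have hzero := eq_zero_of_setIntegral_nonpos hg0 (continuousOn_netFlux hTc) hgb hint
  -- ### `T t` is constant on every sphere about `x₀`
  have hrad : ∀ y z : E3, ‖y - x₀‖ = ‖z - x₀‖ → T t y = T t z := by
    intro y z hyz
    rcases (norm_nonneg (y - x₀)).eq_or_lt with h0 | hpos
    · have hy : y = x₀ := by rw [← sub_eq_zero, ← norm_eq_zero]; exact h0.symm
      have hz : z = x₀ := by rw [← sub_eq_zero, ← norm_eq_zero, ← hyz]; exact h0.symm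
      rw [hy, hz]
    · have hosc : sphOsc (T t) x₀ ‖y - x₀‖ = 0 := by
        have h := hzero ‖y - x₀‖ hpos
        unfold netFlux at h
        rcases mul_eq_zero.1 h with h | h
        · exact absurd h hpos.ne'
        · exact h
      exact sphere_const_of_sphOsc_eq_zero hTb' x₀ hosc (mem_sphere_iff_norm.2 rfl)
        (mem_sphere_iff_norm.2 hyz.symm)
  -- ### radial gradient
  have hTd : DifferentiableOn ℝ (T t) {x₀}ᶜ := by
    have h1 : ContDiffOn ℝ (⊤ : ℕ∞) (T t) {x₀}ᶜ :=
      hsT.comp (contDiffOn_const.prodMk contDiffOn_id) fun y hy => mk_mem_prod (mem_Iio.2 ht) hy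
    exact h1.differentiableOn (by simp)
  exact cross_gradient_eq_zero_of_sphere_const hTd hrad x

/-- **The literal second conjunct of `LineComposition`**: `NetFluxWindowDecay → TypeIVorticityBound →
UnimodalScalarLiouvilleTypeI` (NF-2 is a theorem, so it is not used as a hypothesis). -/
theorem lineComposition_right : NetFluxWindowDecay → TypeIVorticityBound → UnimodalScalarLiouvilleTypeI :=
  fun hS _ => unimodalScalarLiouvilleTypeI_of_netFluxWindowDecay hS

end Summit.NavierStokesRegularity.NavierStokesRegularity.Theorems.PoloidalLiouville.NetFlux

end
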